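import Mathlib
import HarnessLib
import Literature.Computability.AlgebraicComplexity.RealTauKnownCases
import Summits.ValiantsHypothesis.ValiantsHypothesis.Theorems.LacunarySymmetroidMatrixDescartesStubDescartesCeiling

/-!
# ValiantsHypothesis / LacunarySymmetroid — crux `MatrixDescartes` (stmt-ValiantsHypothesis-18050, V1),
# LINE (A) `Cruxes/MatrixDescartes/Lines/product_plus_one.lean` («product-plus-one»): the class's DESCARTES ROW

The line's support class is «all letters diagonal except one diagonal-plus-cyclic letter»; its determinant is
the product-plus-monomial family `c·X^(m·d l₀) + ∏_{j<m} f_j`, `f_j = ∑_l C (a j l) · X^(d l)` — `m` `K`-nomials on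
ONE common support `d` plus one monomial (card `Ideas/product-plus-one.md`; the line's vocabulary is
`fewnomial d b := ∑ l, C (b l) * X ^ (d l)`, `prodPlusMonomial d a l₀ c := C c * X ^ (m * d l₀) + ∏ j, fewnomial d (a j)`,
`PPOLawAt m K B := ∀ d a l₀ c, (prodPlusMonomial d a l₀ c).roots.toFinset.card ≤ B`, UNFOLDED verbatim below).

This file proves the class's DESCARTES ROW and its window corollary, unconditionally and `m`-, `K`-uniformly:

* `card_support_prodPlusMonomial_le` : the member has at most `C(m+K−1, m)` monomials — its exponents are the
  sums `∑_j d (f j)` over row-to-term maps `f : Fin m → Fin K`, i.e. over count vectors (`Sym (Fin K) m`), and the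
  extra monomial `m·d l₀` IS the count vector `replicate m l₀` (it lies in the `m`-fold sumset: the class has the
  FORMAT's monomial support, the critic's price (P1));
* `ppoLawAt_descartes (m K) : PPOLawAt m K (2·C(m+K−1, m) − 1)` (unfolded) — sparse Descartes rule
  (Literature `RealTauKnownCases.card_roots_toFinset_le_of_card_support`: `Z ≤ 2(s−1)+1` for `s` monomials);
* `card_roots_pow_le_of_linearWindow` : `q·(m+K) ≤ K·⌊log₂K⌋ ⇒ Z^q ≤ 2^(K⌊log₂K⌋)`;
* `productPlusOneMDR_linearWindow (q t)` : `ProductPlusOneMDR`'s conclusion `Z^q ≤ 2^(K⌊log₂K⌋)` with the explicit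
  threshold `K₀ = 2^(q(t+1))` in EVERY LINEAR window `m ≤ t·K`.

Honest framing.  A Descartes FLOOR rung of LINE (A): it certifies where the class law is TRIVIAL (`m = O(K)`), hence
that the content of `ProductPlusOneMDR` is exactly the super-linear part `K^{1+ε} ≤ m ≤ 2^{polylog K}` of the crux
window.  It does not touch the line's research stubs (`stub_polyLaw` = bottom rung of Koiran's real τ-conjecture,
`stub_classRowK3`), nor `ProductPlusOneMDR`, `MatrixDescartes` (OPEN), Conjecture B or `VP ≠ VNP`.  No definitions,
no named facts, no `sorry`; Mathlib + Literature + tree only.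
-/

-- `Summit.ValiantsHypothesis.ValiantsHypothesis.…` is the tree's mandated single-conjunct layout (Sub = Summit).
set_option linter.dupNamespace false

namespace Summit.ValiantsHypothesis.ValiantsHypothesis.Theorems.LacunarySymmetroidMatrixDescartes

open Polynomial Finset
open scoped BigOperators Polynomial

namespace ProductPlusOneDescartes

variable {m K : ℕ}

/-- Expansion of a product of `m` fewnomials on the common support `d`: a sum over row-to-term maps
`f : Fin m → Fin K` of the monomials `(∏_j a j (f j)) · X^(∑_j d (f j))`. [folklore] -/
theorem prod_fewnomial_eq (d : Fin K → ℕ) (a : Fin m → Fin K → ℝ) :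
    (∏ j, ∑ l, C (a j l) * (X : ℝ[X]) ^ (d l))
      = ∑ f : Fin m → Fin K, C (∏ j, a j (f j)) * X ^ (∑ j, d (f j)) := by
  rw [Fintype.prod_sum]
  refine Finset.sum_congr rfl fun f _ => ?_
  rw [Finset.prod_mul_distrib, Finset.prod_pow_eq_pow_sum, ← map_prod C]

/-- Coefficients of the product-plus-monomial member vanish off the exponent set `{∑_j d (f j)}`
(the extra monomial `m · d l₀` is the exponent of the constant map `f ≡ l₀`). [folklore] -/
theorem coeff_prodPlusMonomial_eq_zero (d : Fin K → ℕ) (a : Fin m → Fin K → ℝ) (l₀ : Fin K) (c : ℝ)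
    {n : ℕ} (hn : ∀ f : Fin m → Fin K, (∑ j, d (f j)) ≠ n) :
    (C c * X ^ (m * d l₀) + ∏ j, ∑ l, C (a j l) * (X : ℝ[X]) ^ (d l)).coeff n = 0 := by
  have h0 : n ≠ m * d l₀ := by
    intro h
    apply hn (fun _ => l₀)
    rw [Finset.sum_const, Finset.card_univ, Fintype.card_fin, smul_eq_mul, h]
  rw [coeff_add, coeff_C_mul_X_pow, if_neg h0, zero_add, prod_fewnomial_eq, finsetSum_coeff]
  refine Finset.sum_eq_zero fun f _ => ?_
  rw [coeff_C_mul_X_pow, if_neg (fun h => hn f h.symm)]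

/-- The support of the member lies in the image of `Sym (Fin K) m` (count vectors of row-to-term maps) under
`s ↦ ∑_{l ∈ s} d l` — the FORMAT's monomial support. [folklore] -/
theorem support_prodPlusMonomial_subset (d : Fin K → ℕ) (a : Fin m → Fin K → ℝ) (l₀ : Fin K) (c : ℝ) :
    (C c * X ^ (m * d l₀) + ∏ j, ∑ l, C (a j l) * (X : ℝ[X]) ^ (d l)).support
      ⊆ (Finset.univ : Finset (Sym (Fin K) m)).image
          (fun s : Sym (Fin K) m => ((s : Multiset (Fin K)).map d).sum) := by
  intro n hn
  rw [mem_support_iff] at hn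
  by_contra h
  refine hn (coeff_prodPlusMonomial_eq_zero d a l₀ c fun f hf => h ?_)
  refine Finset.mem_image.mpr
    ⟨⟨Finset.univ.val.map f, StubDescartesCeiling.card_map_univ_val f⟩, Finset.mem_univ _, ?_⟩
  rw [← hf, StubDescartesCeiling.sum_eq_sym_sum]
  rfl

/-- **The class has the format's monomial count**: at most `C(m+K−1, m)` monomials (stars and bars). [folklore] -/
theorem card_support_prodPlusMonomial_le (d : Fin K → ℕ) (a : Fin m → Fin K → ℝ) (l₀ : Fin K) (c : ℝ) :
    (C c * X ^ (m * d l₀) + ∏ j, ∑ l, C (a j l) * (X : ℝ[X]) ^ (d l)).support.card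
      ≤ Nat.choose (m + K - 1) m := by
  calc (C c * X ^ (m * d l₀) + ∏ j, ∑ l, C (a j l) * (X : ℝ[X]) ^ (d l)).support.card
      ≤ ((Finset.univ : Finset (Sym (Fin K) m)).image
          (fun s : Sym (Fin K) m => ((s : Multiset (Fin K)).map d).sum)).card :=
        Finset.card_le_card (support_prodPlusMonomial_subset d a l₀ c)
    _ ≤ (Finset.univ : Finset (Sym (Fin K) m)).card := Finset.card_image_le
    _ = Fintype.card (Sym (Fin K) m) := Finset.card_univ
    _ = Nat.choose (K + m - 1) m := by rw [Sym.card_sym_eq_choose, Fintype.card_fin]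
    _ = Nat.choose (m + K - 1) m := by rw [Nat.add_comm K m]

/-- **The class's DESCARTES ROW** — `PPOLawAt m K (2·C(m+K−1, m) − 1)` with the line's vocabulary unfolded:
every member `c·X^(m·d l₀) + ∏_j f_j` has at most `2·C(m+K−1, m) − 1` distinct real zeros (the nonzero ones by the
sparse Descartes rule on `C(m+K−1, m)` monomials, plus possibly `0`; the zero polynomial has no counted roots). [folklore] -/
theorem ppoLawAt_descartes (m K : ℕ) :
    ∀ (d : Fin K → ℕ) (a : Fin m → Fin K → ℝ) (l₀ : Fin K) (c : ℝ),
      (C c * X ^ (m * d l₀) + ∏ j, ∑ l, C (a j l) * (X : ℝ[X]) ^ (d l)).roots.toFinset.card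
        ≤ 2 * Nat.choose (m + K - 1) m - 1 := by
  intro d a l₀ c
  have hK : 0 < K := Fin.pos l₀
  have hch : 1 ≤ Nat.choose (m + K - 1) m := Nat.choose_pos (by omega)
  by_cases hP : (C c * X ^ (m * d l₀) + ∏ j, ∑ l, C (a j l) * (X : ℝ[X]) ^ (d l)) = 0
  · rw [hP, Polynomial.roots_zero, Multiset.toFinset_zero, Finset.card_empty]
    exact Nat.zero_le _
  · have h1 := Literature.Computability.AlgebraicComplexity.card_roots_toFinset_le_of_card_support hP
    have h2 := card_support_prodPlusMonomial_le d a l₀ c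
    omega

/-- Stars-and-bars count under the linear window: `2·C(m+K−1, m) − 1 < 2^(m+K)` (`K ≥ 1`). [folklore] -/
theorem two_mul_choose_lt_two_pow (m K : ℕ) (hK : 0 < K) :
    2 * Nat.choose (m + K - 1) m - 1 < 2 ^ (m + K) := by
  obtain ⟨n, hn⟩ : ∃ n, m + K = n + 1 := ⟨m + K - 1, by omega⟩
  rw [hn, Nat.add_sub_cancel, pow_succ]
  have h1 : Nat.choose n m ≤ 2 ^ n := Nat.choose_le_two_pow _ _
  have h2 : 0 < 2 ^ n := Nat.two_pow_pos n
  omega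

/-- **Window arithmetic of the Descartes row**: if `q·(m+K) ≤ K·⌊log₂K⌋` then `Z^q ≤ 2^(K⌊log₂K⌋)` for every member
(`Z ≤ 2·C(m+K−1,m) − 1 < 2^(m+K)`). [folklore] -/
theorem card_roots_pow_le_of_linearWindow (q m K : ℕ) (h : q * (m + K) ≤ K * Nat.log 2 K)
    (d : Fin K → ℕ) (a : Fin m → Fin K → ℝ) (l₀ : Fin K) (c : ℝ) :
    (C c * X ^ (m * d l₀) + ∏ j, ∑ l, C (a j l) * (X : ℝ[X]) ^ (d l)).roots.toFinset.card ^ q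
      ≤ 2 ^ (K * Nat.log 2 K) := by
  have h1 := ppoLawAt_descartes m K d a l₀ c
  have h2 := two_mul_choose_lt_two_pow m K (Fin.pos l₀)
  calc (C c * X ^ (m * d l₀) + ∏ j, ∑ l, C (a j l) * (X : ℝ[X]) ^ (d l)).roots.toFinset.card ^ q
      ≤ (2 ^ (m + K)) ^ q := Nat.pow_le_pow_left (by omega) q
    _ = 2 ^ (q * (m + K)) := by rw [← pow_mul, Nat.mul_comm]
    _ ≤ 2 ^ (K * Nat.log 2 K) := Nat.pow_le_pow_right (by norm_num) h

/-- **`ProductPlusOneMDR` in every LINEAR window.**  For all `q, t`: every member of format `(m, K)` with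
`m ≤ t·K` and `K ≥ 2^(q(t+1))` has `Z^q ≤ 2^(K⌊log₂K⌋)` — the conclusion of the line's restricted V1
`ProductPlusOneMDR` (`∀ c q, 0 < q → ∃ K₀, ∀ K m, K₀ ≤ K → m ≤ 2^((⌊log₂K⌋+c)^c) → ∀ d a l₀ c₀, Z^q ≤ 2^(K⌊log₂K⌋)`)
with the quasi-polynomial window replaced by a linear one and the threshold made explicit.  Descartes FLOOR: the
content of `ProductPlusOneMDR` is the regime `K^{1+ε} ≤ m`, untouched here. [folklore] -/
theorem productPlusOneMDR_linearWindow (q t : ℕ) :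
    ∀ K m : ℕ, 2 ^ (q * (t + 1)) ≤ K → m ≤ t * K →
      ∀ (d : Fin K → ℕ) (a : Fin m → Fin K → ℝ) (l₀ : Fin K) (c₀ : ℝ),
        (C c₀ * X ^ (m * d l₀) + ∏ j, ∑ l, C (a j l) * (X : ℝ[X]) ^ (d l)).roots.toFinset.card ^ q
          ≤ 2 ^ (K * Nat.log 2 K) := by
  intro K m hK hm d a l₀ c₀
  refine card_roots_pow_le_of_linearWindow q m K ?_ d a l₀ c₀
  have hlog : q * (t + 1) ≤ Nat.log 2 K := Nat.le_log_of_pow_le (by norm_num) hK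
  calc q * (m + K) ≤ q * (t * K + K) := Nat.mul_le_mul_left q (by omega)
    _ = (q * (t + 1)) * K := by ring
    _ ≤ Nat.log 2 K * K := Nat.mul_le_mul_right K hlog
    _ = K * Nat.log 2 K := Nat.mul_comm _ _

/-- The window `m ≤ K` (`t = 1`): `K ≥ 4^q ⇒ Z^q ≤ 2^(K⌊log₂K⌋)` for every member with `m ≤ K`. [folklore] -/
theorem productPlusOneMDR_window_le (q : ℕ) :
    ∀ K m : ℕ, 4 ^ q ≤ K → m ≤ K →
      ∀ (d : Fin K → ℕ) (a : Fin m → Fin K → ℝ) (l₀ : Fin K) (c₀ : ℝ),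
        (C c₀ * X ^ (m * d l₀) + ∏ j, ∑ l, C (a j l) * (X : ℝ[X]) ^ (d l)).roots.toFinset.card ^ q
          ≤ 2 ^ (K * Nat.log 2 K) := by
  intro K m hK hm
  refine productPlusOneMDR_linearWindow q 1 K m ?_ (by omega)
  calc 2 ^ (q * (1 + 1)) = 4 ^ q := by rw [Nat.mul_comm, pow_mul]; norm_num
    _ ≤ K := hK

end ProductPlusOneDescartes

end Summit.ValiantsHypothesis.ValiantsHypothesis.Theorems.LacunarySymmetroidMatrixDescartes
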